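import Summits.BirchSwinnertonDyer.BirchSwinnertonDyer.Theorems.Rank2Observatory2DescClCurveCertE2RN
import Summits.BirchSwinnertonDyer.BirchSwinnertonDyer.Theorems.Rank2Observatory2DescClCurveCertE2X
import HarnessLib

/-!
# BirchSwinnertonDyer — rank ≥ 2 observatory: KERNEL-2DESC-CL — NODAL LOCAL CONDITIONS ON THE NON-CYCLIC COMPLEX TWO-VIEW HOST (E2N)

HONEST FRAMING: per-curve certified theorems and census instruments; no claim on BSD in rank ≥ 2.

The complex (one real place) two-view per-curve checker of `…ClCurveCertE2` (field record `ClFieldCertE2` with the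
second generator `η`, per-curve record `ClCurveCertE2`, family `fam2`, sieve `adm2`) refined by **nodal local
conditions at split primes** — the exact twin of the landed `…ClCurveCertE2RN` (totally real host) and
`…ClCurveCertE3N` (cyclic split-`q` host): for each listed prime `ℓ` at which the field cubic has three `ℤ_ℓ`-roots
(Hensel certificates, record `NodalCert` of `…E3N`), the kernel class vector of a sieve survivor `U` must lie in the
enumerated split local image (`splitImgOdd` / `splitImgTwo` of `…SplitImageNodal{,Two}`).  Record `ClCurveCertE2N
{cc, nod, nod2}`; the computable clauses `nodRootsE2 / nodTableE2 / nodalClauseOddE2 / nodalClauseTwoE2` are the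
ones of `…E2RN` (stated over `ClCurveCertE2` there; imported, not restated); new here: the sieve conjunct `extraE2N`,
the checker `checkE2N r = checkE2Core ∧ nodal clauses ∧ #{(T,U) : adm2 ∧ extraE2N} ≤ 2^r`, its soundness
`rank_le_of_checkE2N` (= `rank_le_of_checkE2X` of `…ClCurveCertE2X` with `extra := extraE2N c`, discharged by
`uvecOdd_mem_splitImgOdd` / `uvecTwo_mem_splitImgTwo` over `sqClassMapOdd ℓ` / `sqClassMapTwo`), `rank_eq_of_checkE2N`
and the `K`-free row shapes `rank_eq_of_certsE2N{,_scaled,_complSq,_plain}`.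
Sorry-free; axioms `propext`, `Classical.choice`, `Quot.sound`.
[cite: Cassels1991LecturesEllipticCurves, §15] [cite: CremonaAlgorithms1997, §3.6] [cite: Cohen1993, §4.8.2, §6.2, §6.5]
[cite: SilvermanAEC2009, X.1.1]
-/

set_option linter.dupNamespace false

noncomputable section

open scoped Classical NumberField nonZeroDivisors

open Literature.NumberTheory.NumberFields Polynomial Module NumberField IsDedekindDomain Ideal

namespace Summit.BirchSwinnertonDyer.BirchSwinnertonDyer.Rank2Observatory.TwoDescCl

open TwoDescCubic ClFieldCert SplitImage TwoDescPadic

/-! ## Records -/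

/-- **Per-curve record with nodal local conditions (non-cyclic complex host, one real place)**: the two-view record
of `…ClCurveCertE2`, the odd nodal primes and the `2`-adic nodal certificates (field `ℓ` must be `2` there).
[cite: Cassels1991LecturesEllipticCurves, §15] -/
structure ClCurveCertE2N where
  /-- the complex two-view per-curve record -/
  cc : ClCurveCertE2
  /-- odd nodal primes -/
  nod : List NodalCert
  /-- `2`-adic nodal certificates -/
  nod2 : List NodalCert

/-! ## Kernel clauses (computable) -/

section Kernel

/-- **The nodal sieve conjunct**: the kernel class vector of `U` lies in the enumerated local image at every listed
prime. [cite: Cassels1991LecturesEllipticCurves, §15] -/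
def extraE2N (c : ClCurveCertE2N) (U : Finset (Fin (fam2 c.cc).length)) : Bool :=
  (c.nod.all fun n => decide (uvecOdd n.ℓ (nodTableE2 c.cc n) U ∈ splitImgOdd n.ℓ (nodRootsE2 c.cc n))) &&
    (c.nod2.all fun n => decide (uvecTwo (nodTableE2 c.cc n) U ∈ splitImgTwo (nodRootsE2 c.cc n)))

variable (F : ClFieldCertE2) (c : ClCurveCertE2N)

/-- **The complex two-view per-curve checker with nodal local conditions for `rank ≤ r`**: the core clauses
of `checkE2`, the nodal kernel clauses, and the count of survivors of `adm2 ∧ extraE2N` `≤ 2 ^ r`. Computable; run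
by `decide +kernel`. [cite: Cassels1991LecturesEllipticCurves, §15] -/
def checkE2N (r : ℕ) : Bool :=
  checkE2Core F c.cc && (c.nod.all fun n => nodalClauseOddE2 F.fe.base c.cc n) &&
    (c.nod2.all fun n => nodalClauseTwoE2 F.fe.base c.cc n) &&
    decide (((Finset.univ ×ˢ Finset.univ).filter
      (fun p : Finset (Fin 0) × Finset (Fin (fam2 c.cc).length) =>
        (adm2 F c.cc p.1 p.2 && extraE2N c p.2) = true)).card ≤ 2 ^ r)

end Kernel

/-! ## Soundness -/

section Sound

variable {K : Type*} [Field K] [NumberField K] {θ : K}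

/-- **Soundness of the complex two-view checker with nodal local conditions: `rank E(ℚ) ≤ r`.**
[cite: Cassels1991LecturesEllipticCurves, §15] [cite: CremonaAlgorithms1997, §3.6] -/
theorem rank_le_of_checkE2N (r : ℕ) (F : ClFieldCertE2)
    (hθ : aeval θ (MonicCubic.poly F.fe.base.a F.fe.base.b F.fe.base.c) = 0)
    (h3 : finrank ℚ K = 3) (h2 : F.check2 = true) (hpr : F.fe.primeListE.Forall Nat.Prime)
    (c : ClCurveCertE2N) (hnp : (c.nod.map NodalCert.ℓ).Forall Nat.Prime) (hc : checkE2N F c r = true) :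
    ((⟨0, c.cc.A, 0, c.cc.B, c.cc.C⟩ : WeierstrassCurve ℚ)).mordellWeilRank ≤ r := by
  classical
  unfold checkE2N at hc
  have hcount := of_decide_eq_true (Bool.and_eq_true_iff.mp hc).2
  have h123 := (Bool.and_eq_true_iff.mp hc).1
  have hnod2 := List.all_eq_true.mp (Bool.and_eq_true_iff.mp h123).2
  have hnod := List.all_eq_true.mp (Bool.and_eq_true_iff.mp (Bool.and_eq_true_iff.mp h123).1).2
  have hcore := (Bool.and_eq_true_iff.mp (Bool.and_eq_true_iff.mp h123).1).1
  have hK := F.const_of_check2 h2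
  have hE := F.fe.checkCoreE_of_checkE (F.checkE_of_check2 h2)
  have hR := F.fe.checkReg_of_coreE hE
  have hirr := F.fe.base.irreducible_of_reg hR
  have hm : (F.r₁ : ℤ) ≠ 0 := Nat.cast_ne_zero.mpr (F.r₁_pos hK).ne'
  have hmcast : (((F.r₁ : ℤ) ^ 2 : ℤ) : 𝓞 K) = (F.m₁ : 𝓞 K) := by
    simp only [ClFieldCertE2.m₁, Nat.cast_pow, Int.cast_pow, Int.cast_natCast]
  refine rank_le_of_checkE2X r F hθ h3 h2 hpr c.cc hcore (extraE2N c) ?_ ?_ hcount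
  · -- `extraE2N ∅`: the class vector of `∅` is `0 ∈` every local image
    simp only [extraE2N, Bool.and_eq_true, List.all_eq_true, decide_eq_true_eq]
    exact ⟨fun n _ => by rw [uvecOdd_empty]; exact zero_mem_splitImgOdd _ _,
      fun n _ => by rw [uvecTwo_empty]; exact zero_mem_splitImgTwo _⟩
  · intro e W he hW hW0 hroot x y hxy hy U hsq
    have he' : (((F.r₁ : ℤ) ^ 2 : ℤ) : 𝓞 K) * e = lin hθ c.cc.Xt.1 c.cc.Xt.2.1 c.cc.Xt.2.2 := by
      rw [hmcast]; exact he
    have hW' : ∀ j, (((F.r₁ : ℤ) ^ 2 : ℤ) : 𝓞 K) * W j = lin hθ ((fam2 c.cc).get j).X.1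
        ((fam2 c.cc).get j).X.2.1 ((fam2 c.cc).get j).X.2.2 := fun j => by rw [hmcast]; exact hW j
    simp only [extraE2N, Bool.and_eq_true, List.all_eq_true, decide_eq_true_eq]
    refine ⟨fun n hn => ?_, fun n hn => ?_⟩
    · -- an odd nodal prime
      have hcl := hnod n hn
      simp only [nodalClauseOddE2, henselAll, Bool.and_eq_true, Bool.not_eq_true', decide_eq_false_iff_not,
        decide_eq_true_eq] at hcl
      obtain ⟨⟨⟨⟨hℓ2, ⟨hh0, hh1⟩, hh2⟩, hdist⟩, hdepth⟩, hprec⟩ := hcl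
      have hp : n.ℓ.Prime := List.forall_iff_forall_mem.mp hnp n.ℓ (List.mem_map.mpr ⟨n, hn, rfl⟩)
      haveI : Fact n.ℓ.Prime := ⟨hp⟩
      obtain ⟨R0⟩ := nonempty_rootedPrime_of_henselCheck (θ := θ) hirr hθ h3 hh0
      obtain ⟨R1⟩ := nonempty_rootedPrime_of_henselCheck (θ := θ) hirr hθ h3 hh1
      obtain ⟨R2⟩ := nonempty_rootedPrime_of_henselCheck (θ := θ) hirr hθ h3 hh2
      have hφ : ∀ i : Fin 3, (![R0.φ, R1.φ, R2.φ] : Fin 3 → (K →+* ℚ_[n.ℓ])) i θ =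
          ((![R0.z, R1.z, R2.z] : Fin 3 → ℤ_[n.ℓ]) i : ℚ_[n.ℓ]) := by
        intro i; fin_cases i
        exacts [R0.φ_theta, R1.φ_theta, R2.φ_theta]
      have hclose : ∀ i : Fin 3, ‖(![R0.z, R1.z, R2.z] : Fin 3 → ℤ_[n.ℓ]) i - (n.ar i : ℤ_[n.ℓ])‖ ≤
          (n.ℓ : ℝ) ^ (-(n.N : ℤ)) := by
        intro i; fin_cases i
        exacts [R0.close, R1.close, R2.close]
      exact uvecOdd_mem_splitImgOdd (SqClassOdd.sqClassMapOdd n.ℓ) hℓ2 hθ hφ hclose hm he' hroot hW' hW0 hxy hy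
        hsq hdist hdepth hprec
    · -- a `2`-adic nodal certificate
      have hcl := hnod2 n hn
      simp only [nodalClauseTwoE2, henselAll, Bool.and_eq_true, decide_eq_true_eq] at hcl
      obtain ⟨⟨⟨⟨hℓ, ⟨hh0, hh1⟩, hh2⟩, hdist⟩, hdepth⟩, hprec⟩ := hcl
      rw [hℓ] at hh0 hh1 hh2
      obtain ⟨R0⟩ := nonempty_rootedPrime_of_henselCheck (θ := θ) hirr hθ h3 hh0
      obtain ⟨R1⟩ := nonempty_rootedPrime_of_henselCheck (θ := θ) hirr hθ h3 hh1
      obtain ⟨R2⟩ := nonempty_rootedPrime_of_henselCheck (θ := θ) hirr hθ h3 hh2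
      have hφ : ∀ i : Fin 3, (![R0.φ, R1.φ, R2.φ] : Fin 3 → (K →+* ℚ_[2])) i θ =
          ((![R0.z, R1.z, R2.z] : Fin 3 → ℤ_[2]) i : ℚ_[2]) := by
        intro i; fin_cases i
        exacts [R0.φ_theta, R1.φ_theta, R2.φ_theta]
      have hclose : ∀ i : Fin 3, ‖(![R0.z, R1.z, R2.z] : Fin 3 → ℤ_[2]) i - (n.ar i : ℤ_[2])‖ ≤
          ((2 : ℕ) : ℝ) ^ (-(n.N : ℤ)) := by
        intro i; fin_cases i
        exacts [R0.close, R1.close, R2.close]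
      exact uvecTwo_mem_splitImgTwo SqClassTwo.sqClassMapTwo hθ hφ hclose hm he' hroot hW' hW0 hxy hy hsq hdist
        hdepth hprec

/-- **`rank E(ℚ) = r`** (complex two-view field, nodal local conditions) from the checked records and a tree
lower bound. [cite: CremonaAlgorithms1997, §3.6] -/
theorem rank_eq_of_checkE2N (r : ℕ) (F : ClFieldCertE2)
    (hθ : aeval θ (MonicCubic.poly F.fe.base.a F.fe.base.b F.fe.base.c) = 0)
    (h3 : finrank ℚ K = 3) (h2 : F.check2 = true) (hpr : F.fe.primeListE.Forall Nat.Prime)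
    (c : ClCurveCertE2N) (hnp : (c.nod.map NodalCert.ℓ).Forall Nat.Prime) (hc : checkE2N F c r = true)
    (hlow : r ≤ (((⟨0, c.cc.A, 0, c.cc.B, c.cc.C⟩ : WeierstrassCurve ℤ)).map
      (Int.castRingHom ℚ)).mordellWeilRank) :
    (((⟨0, c.cc.A, 0, c.cc.B, c.cc.C⟩ : WeierstrassCurve ℤ)).map (Int.castRingHom ℚ)).mordellWeilRank =
      r := by
  have hV : ((⟨0, c.cc.A, 0, c.cc.B, c.cc.C⟩ : WeierstrassCurve ℤ)).map (Int.castRingHom ℚ) =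
      (⟨0, c.cc.A, 0, c.cc.B, c.cc.C⟩ : WeierstrassCurve ℚ) := by
    ext <;> simp [WeierstrassCurve.map]
  refine le_antisymm ?_ hlow
  rw [hV]
  exact rank_le_of_checkE2N r F hθ h3 h2 hpr c hnp hc

end Sound

/-! ## `K`-free wrappers over the model `CubicField a b c` -/

section Rows

/-- **`rank E(ℚ) = r` from the records** (model `(0, A, 0, B, C)`, complex host, nodal local conditions).
[cite: Cassels1991LecturesEllipticCurves, §15] [cite: CremonaAlgorithms1997, §3.6] -/
theorem rank_eq_of_certsE2N (r : ℕ) (F : ClFieldCertE2) (c : ClCurveCertE2N) (h2 : F.check2 = true)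
    (hpr : F.fe.primeListE.Forall Nat.Prime) (hnp : (c.nod.map NodalCert.ℓ).Forall Nat.Prime)
    (hc : checkE2N F c r = true)
    (hlow : r ≤ (((⟨0, c.cc.A, 0, c.cc.B, c.cc.C⟩ : WeierstrassCurve ℤ)).map
      (Int.castRingHom ℚ)).mordellWeilRank) :
    (((⟨0, c.cc.A, 0, c.cc.B, c.cc.C⟩ : WeierstrassCurve ℤ)).map (Int.castRingHom ℚ)).mordellWeilRank =
      r := by
  haveI : Fact (Irreducible (MonicCubic.polyQ F.fe.base.a F.fe.base.b F.fe.base.c)) :=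
    ⟨F.fe.base.irreducible_of_reg (F.fe.checkReg_of_coreE (F.fe.checkCoreE_of_checkE (F.checkE_of_check2 h2)))⟩
  exact rank_eq_of_checkE2N (K := CubicField F.fe.base.a F.fe.base.b F.fe.base.c) r F
    (CubicField.aeval_root _ _ _) (CubicField.finrank_eq _ _ _) h2 hpr c hnp hc hlow

/-- **`rank E(ℚ) = r` for the ORIGINAL model** `(a₁, a₂, a₃, a₄, a₆)` when the records certify its completed-square
model rescaled by `d ≠ 0`. [cite: CremonaAlgorithms1997, §3.6] [cite: SilvermanAEC2009, III.3.1(b)] -/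
theorem rank_eq_of_certsE2N_scaled (r : ℕ) (F : ClFieldCertE2) (c : ClCurveCertE2N) (h2 : F.check2 = true)
    (hpr : F.fe.primeListE.Forall Nat.Prime) (hnp : (c.nod.map NodalCert.ℓ).Forall Nat.Prime)
    (hc : checkE2N F c r = true) (a₁ a₂ a₃ a₄ a₆ d : ℤ) (hd : d ≠ 0)
    (hABC : c.cc.A = d ^ 2 * (a₁ ^ 2 + 4 * a₂) ∧ c.cc.B = d ^ 4 * (8 * (a₁ * a₃ + 2 * a₄)) ∧
      c.cc.C = d ^ 6 * (16 * (a₃ ^ 2 + 4 * a₆)))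
    (hlow : r ≤ (((⟨a₁, a₂, a₃, a₄, a₆⟩ : WeierstrassCurve ℤ)).map (Int.castRingHom ℚ)).mordellWeilRank) :
    (((⟨a₁, a₂, a₃, a₄, a₆⟩ : WeierstrassCurve ℤ)).map (Int.castRingHom ℚ)).mordellWeilRank = r := by
  obtain ⟨hA, hB, hC⟩ := hABC
  rw [mordellWeilRank_complSq_scaled a₁ a₂ a₃ a₄ a₆ d hd, ← hA, ← hB, ← hC] at hlow ⊢
  exact rank_eq_of_certsE2N r F c h2 hpr hnp hc hlow

/-- The plain completed-square shape (`d = 1`). [cite: CremonaAlgorithms1997, §3.6] -/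
theorem rank_eq_of_certsE2N_complSq (r : ℕ) (F : ClFieldCertE2) (c : ClCurveCertE2N) (h2 : F.check2 = true)
    (hpr : F.fe.primeListE.Forall Nat.Prime) (hnp : (c.nod.map NodalCert.ℓ).Forall Nat.Prime)
    (hc : checkE2N F c r = true) (a₁ a₂ a₃ a₄ a₆ : ℤ)
    (hABC : c.cc.A = a₁ ^ 2 + 4 * a₂ ∧ c.cc.B = 8 * (a₁ * a₃ + 2 * a₄) ∧ c.cc.C = 16 * (a₃ ^ 2 + 4 * a₆))
    (hlow : r ≤ (((⟨a₁, a₂, a₃, a₄, a₆⟩ : WeierstrassCurve ℤ)).map (Int.castRingHom ℚ)).mordellWeilRank) :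
    (((⟨a₁, a₂, a₃, a₄, a₆⟩ : WeierstrassCurve ℤ)).map (Int.castRingHom ℚ)).mordellWeilRank = r :=
  rank_eq_of_certsE2N_scaled r F c h2 hpr hnp hc a₁ a₂ a₃ a₄ a₆ 1 one_ne_zero
    (by obtain ⟨hA, hB, hC⟩ := hABC; exact ⟨by rw [hA]; ring, by rw [hB]; ring, by rw [hC]; ring⟩) hlow

/-- Row plumbing for a plain model `y² = x³ + a₂x² + a₄x + a₆`: the record's cubic IS the curve.
[cite: Cassels1991LecturesEllipticCurves, §15] -/
theorem rank_eq_of_certsE2N_plain (r : ℕ) (F : ClFieldCertE2) (c : ClCurveCertE2N) (h2 : F.check2 = true)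
    (hpr : F.fe.primeListE.Forall Nat.Prime) (hnp : (c.nod.map NodalCert.ℓ).Forall Nat.Prime)
    (hc : checkE2N F c r = true) (a₂ a₄ a₆ : ℤ) (hABC : c.cc.A = a₂ ∧ c.cc.B = a₄ ∧ c.cc.C = a₆)
    (hlow : r ≤ (((⟨0, a₂, 0, a₄, a₆⟩ : WeierstrassCurve ℤ)).map (Int.castRingHom ℚ)).mordellWeilRank) :
    (((⟨0, a₂, 0, a₄, a₆⟩ : WeierstrassCurve ℤ)).map (Int.castRingHom ℚ)).mordellWeilRank = r := by
  obtain ⟨rfl, rfl, rfl⟩ := hABC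
  exact rank_eq_of_certsE2N r F c h2 hpr hnp hc hlow

end Rows

end Summit.BirchSwinnertonDyer.BirchSwinnertonDyer.Rank2Observatory.TwoDescCl

end
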